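import Summits.SmoothPoincare4.SmoothPoincare4.Theses.WeakReductionDescent
import Literature.Topology.FourManifolds.ConnectedSumSphereIdentity
import HarnessLib

/-!
# Route WeakReductionDescent — support item `SphereSumSphere` (stmt-SmoothPoincare4-17913)

A connected sum (in the tree's relational sense `Literature.Topology.FourManifolds.IsConnectedSum`,
models `𝓡 4`) of two smooth 4-manifolds `A`, `B` each diffeomorphic to the round sphere `S⁴` is
diffeomorphic to `S⁴`.

This is the instance `n = 4` (all three carriers in `Type`) of the Literature fact
`Literature.Topology.FourManifolds.connectedSum_sphere_sphere n` (`ConnectedSumSpheres.lean`;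
Kervaire–Milnor, *Groups of homotopy spheres I*, Ann. of Math. 77 (1963), §2, Lemma 2.1: the
connected sum is well defined and `Sⁿ` serves as identity element), which is PROVED in the tree by
`Literature.Topology.FourManifolds.connectedSum_sphere_sphere_holds`
(`ConnectedSumSphereIdentity.lean`: transport the `B`-piece to `S⁴` itself along the given
diffeomorphism, `IsConnectedSum.of_diffeomorph_right`, then `X # Sⁿ ≅ X`,
`nonempty_diffeomorph_of_isConnectedSum_sphere'`, with `X = A ≅ S⁴`). No orientation or
homotopy-sphere hypothesis is needed, and the two `SecondCountableTopology` binders of the route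
statement are idle.

## References

* M. Kervaire, J. Milnor, *Groups of homotopy spheres I*, Ann. of Math. 77 (1963), §2, Lemma 2.1.
  [KervaireMilnorAnnals1963]
* A. Kosinski, *Differential Manifolds* (1993), Ch. VI §1. [Kosinski1993]
-/

-- the registered namespace `Summit.SmoothPoincare4.SmoothPoincare4.Theorems` repeats a component
set_option linter.dupNamespace false

namespace Summit.SmoothPoincare4.SmoothPoincare4.Theorems

open scoped Manifold ContDiff

/-- **Support item `SphereSumSphere` of route WeakReductionDescent** (stmt-SmoothPoincare4-17913):
if the smooth 4-manifold `M` is a connected sum `A # B`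
(`Literature.Topology.FourManifolds.IsConnectedSum (𝓡 4) (𝓡 4) (𝓡 4) A B M`) of smooth
4-manifolds `A ≅ S⁴` and `B ≅ S⁴`, then `M ≅ S⁴`. Proof: the case `n = 4` of the proved Literature
fact `connectedSum_sphere_sphere 4` (Kervaire–Milnor 1963, Lemma 2.1; discharged by
`Literature.Topology.FourManifolds.connectedSum_sphere_sphere_holds`).
[cite: KervaireMilnorAnnals1963, §2, Lemma 2.1 (p. 505)] -/
theorem SphereSumSphere_proof :
    Summit.SmoothPoincare4.SmoothPoincare4.Theses.WeakReductionDescent.SphereSumSphere := by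
  unfold Summit.SmoothPoincare4.SmoothPoincare4.Theses.WeakReductionDescent.SphereSumSphere
  intro A _ _ _ _ _ B _ _ _ _ _ M _ _ _ _ _ h hA hB
  exact Literature.Topology.FourManifolds.connectedSum_sphere_sphere_holds 4 (by norm_num)
    A B M h hA hB

end Summit.SmoothPoincare4.SmoothPoincare4.Theorems
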